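import Summits.QuantumFields.YangMills.Theorems.UnitScaleTiltProp7TrueLinPureGauge
import Literature.MathematicalPhysics.QuantumFieldTheory.Balaban1983to89.B7TransferAnalyticMean
import HarnessLib

/-!
# Route `UnitScaleTilt`, crux K1 «MinimiserStabilityRegPr» (stmt-QuantumFields-19200), route-R [RP] curved, row (n3) F0 —
# REALITY OF THE TRUE LINEARISATION: the true one-step operator `T_V` of the (0.4) average (the `hQs` letters of record), every recursion
# family `Q k`, the covariant comb mean `CM_V`, the coarse pure gauge `P_V`, the (sourced) reduced family `G` and the coarse gauge function `Λ`
# of record map `𝔰𝔲(N)`-valued fields to `𝔰𝔲(N)`-valued fields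

Cell `ym3-torus`, D-0154 (3c) twin-width seat `ym-routeR-w2` (gen 3); row F0 of the namer's cut (★p1 g14, 2026-08-28 15:11Z «conserved-current shortcut»):
the gauge correction `μ := −Λ_k` in `|Lin_W(iD)| ≤ 2eℓ⁻¹·Σ_c‖Q^{(k)}(iD)(c) − (μ(c₋) − W̄(c)μ(c₊)W̄(c)*)‖` must be `𝔰𝔲(N)`-valued (the exponential curve of the exact
pairing lives in `SU(N)`), and `Λ_k` is built from `D₀ = iD` by the recursions of record.  THEOREMS ONLY (0 `def`, 0 `sorry`); `--supports stmt-QuantumFields-19200`,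
count-neutral.  YM₃ on T³ is a ladder rung (R3), not the Clay problem; nothing here claims the stub, the crux, d = 4 or the mass gap.

«`𝔰𝔲(N)`-valued» is spelled `star X = -X ∧ X.trace = 0` (no new letter), as in ✓ `Prop7QTwSReality`.

THE ONE ANALYTIC POINT (§2 ★★ `fderiv_eml_mul_star_su`).  For a tuple `W` of `SU(N)` matrices on the (0.4) guard (`‖W_i − 1‖ < δ_N`) and `𝔰𝔲(N)`-valued `A_i`:
`D eml(W)[i ↦ A_i·W_i]·eml(W)* ∈ 𝔰𝔲(N)`.  Proof: it is the derivative at `t = 0` of the real curve `t ↦ log(eml{e^{tA_i}W_i}·eml{W_i}*)` (chain rule through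
✓ `ExpMeanLog.differentiableAt_eml` and ✓ `B7TransferAnalyticMean.hasFDerivAt_mlog_one`), a curve which is `𝔰𝔲(N)`-VALUED for small real `t` — `e^{tA_i}W_i ∈ SU(N)` stays on
the guard, so `eml{…} ∈ SU(N)` ((0.9), ✓ `eml_mem_specialUnitaryGroup`) and `log` of `SU(N)` near `1` is skew-Hermitian traceless (✓ `star_mlog_eq_neg`, ✓ `trace_mlog_eq_zero`) —
and `𝔰𝔲(N)` is a CLOSED real subspace, so the limit of the slopes stays in it (the closed-subspace trick of ✓ `Prop7ChartRealityTwS.fderiv_apply_mem_of_mapsTo_of_ball`, run on a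
real one-parameter curve).  Everything else is algebra: covariant signed sums, unitary conjugations, real averages and differences of `𝔰𝔲(N)`-valued data are `𝔰𝔲(N)`-valued,
and the families of record are reached by induction along their displayed recursions.

WHAT IS PROVED (ns `…Theorems.Prop7TrueLinReality`; `SU(n)` for any `Fintype n`, any `P`).
* §1 closure letters: `su_zero`, `su_add`, `su_sub`, `su_neg`, `su_smul_real`, `su_sum`, `su_conj` (unitary conjugation), `su_covStep`, ★ `su_covWalkSum`;
  §2 letters `isClosed_su`, `exp_smul_mem_specialUnitaryGroup`, `guard_facts` (the star of an `SU(N)` matrix: ✓ `FederbushMean.star_mem_SU`).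
* §2 ★★ `fderiv_eml_mul_star_su` (the analytic point above).
* §3 ★★ `su_trueLin` — the true one-step operator `T_V` (the `hQs` letters VERBATIM at a background `V`) on the (0.4) guard at `c`; `su_covCombMean` (`CM_V`), `su_pureGauge` (`P_V`).
* The FAMILIES along the background tower (every recursion family `Q`, the (sourced) reduced family `G`, the coarse gauge function `Λ`, the plain sourced family `D`) are
  the sequel `UnitScaleTiltProp7TrueLinRealityFamilies` (inductions over this file's §3).
HONEST SCOPE.  Linear-algebra and one derivative; nothing of [Balaban1985Averaging] ∕ [Balaban1985BackgroundPropagators] is asserted beyond the cited tree theorems.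

References: T. Bałaban, CMP 99 (1985) 389–434 [Balaban1985BackgroundPropagators] ((3.13)–(3.14) p.393: the averaging derivative is `𝔤`-valued); CMP 102 (1985) 277–309
[Balaban1985Variational] ((51) p.286); CMP 109 (1987) 249–301 [Balaban1987RG1] ((0.4)–(0.9) p.253); CMP 95 (1984) 17–40 [Balaban1984PropagatorsI] ((1.18)–(1.20) pp.19–20).
-/

set_option autoImplicit false

noncomputable section

open scoped BigOperators Matrix.Norms.L2Operator Topology
open Filter NormedSpace Metric Set

namespace Summit.QuantumFields.YangMills.Theorems.Prop7TrueLinReality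

open Literature.MathematicalPhysics.QuantumFieldTheory.Balaban1983to89
open Finset T4Continuum BlockAveraging AveragingRT ExpMeanLog BlockAveragingEMLLinearised BlockAveragingEMLLinearisedBackground BlockAveragingEMLProp2
open MatrixLog (mlog mlog_one)
open Literature.Analysis.Matrix (det_exp_eq_exp_trace)
open B7TransferAnalyticMean (hasFDerivAt_mlog_one)
open Summit.QuantumFields.YangMills.Theorems.Prop7HolRatioPerStep (coe_star_mul_self coe_mul_star_self stepFactor_mul_star' star_mul_stepFactor')
open Summit.QuantumFields.YangMills.Theorems.Prop7TrueLinPureGauge (coe_corr_eq_eml)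

variable {n : Type*} [Fintype n] [DecidableEq n] [Nonempty n]

section Algebra

omit [DecidableEq n] [Nonempty n]

/-! ## §1 Closure letters for `𝔰𝔲(N)`-valued matrices (`star X = -X ∧ tr X = 0`) -/

/-- `0 ∈ 𝔰𝔲(N)`. [folklore] -/
theorem su_zero : star (0 : Matrix n n ℂ) = -0 ∧ (0 : Matrix n n ℂ).trace = 0 := by simp

/-- `𝔰𝔲(N)` is closed under addition. [folklore] -/
theorem su_add {X Y : Matrix n n ℂ} (hX : star X = -X ∧ X.trace = 0) (hY : star Y = -Y ∧ Y.trace = 0) :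
    star (X + Y) = -(X + Y) ∧ (X + Y).trace = 0 := by
  refine ⟨?_, ?_⟩
  · rw [star_add, hX.1, hY.1, neg_add]
  · rw [Matrix.trace_add, hX.2, hY.2, add_zero]

/-- `𝔰𝔲(N)` is closed under negation. [folklore] -/
theorem su_neg {X : Matrix n n ℂ} (hX : star X = -X ∧ X.trace = 0) : star (-X) = -(-X) ∧ (-X).trace = 0 := by
  refine ⟨?_, ?_⟩
  · rw [star_neg, hX.1]
  · rw [Matrix.trace_neg, hX.2, neg_zero]

/-- `𝔰𝔲(N)` is closed under subtraction. [folklore] -/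
theorem su_sub {X Y : Matrix n n ℂ} (hX : star X = -X ∧ X.trace = 0) (hY : star Y = -Y ∧ Y.trace = 0) :
    star (X - Y) = -(X - Y) ∧ (X - Y).trace = 0 := by
  rw [sub_eq_add_neg]; exact su_add hX (su_neg hY)

/-- `𝔰𝔲(N)` is a REAL subspace: closed under real-valued complex scalars (`star c = c`). [folklore] -/
theorem su_smul_real {c : ℂ} (hc : star c = c) {X : Matrix n n ℂ} (hX : star X = -X ∧ X.trace = 0) :
    star (c • X) = -(c • X) ∧ (c • X).trace = 0 := by
  refine ⟨?_, ?_⟩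
  · rw [star_smul, hc, hX.1, smul_neg]
  · rw [Matrix.trace_smul, hX.2, smul_zero]

/-- The averaging weight `|I|⁻¹` is real. [folklore] -/
theorem star_inv_natCast (m : ℕ) : star ((m : ℂ))⁻¹ = ((m : ℂ))⁻¹ := by
  rw [star_inv₀, star_natCast]

/-- `𝔰𝔲(N)` is closed under finite sums. [folklore] -/
theorem su_sum {ι : Type*} (s : Finset ι) {f : ι → Matrix n n ℂ} (hf : ∀ i ∈ s, star (f i) = -f i ∧ (f i).trace = 0) :
    star (∑ i ∈ s, f i) = -(∑ i ∈ s, f i) ∧ (∑ i ∈ s, f i).trace = 0 := by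
  classical
  induction s using Finset.induction_on with
  | empty => simp
  | insert a s ha ih =>
    rw [Finset.sum_insert ha]
    exact su_add (hf a (Finset.mem_insert_self a s)) (ih fun i hi => hf i (Finset.mem_insert_of_mem hi))

end Algebra

omit [Nonempty n] in
/-- **Unitary conjugation preserves `𝔰𝔲(N)`**: `(gXg*)* = gX*g* = −gXg*` and `tr(gXg*) = tr(X g*g) = tr X`. [folklore] -/
theorem su_conj {g : Matrix n n ℂ} (hg : star g * g = 1) {X : Matrix n n ℂ} (hX : star X = -X ∧ X.trace = 0) :
    star (g * X * star g) = -(g * X * star g) ∧ (g * X * star g).trace = 0 := by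
  refine ⟨?_, ?_⟩
  · rw [star_mul, star_mul, star_star, hX.1, neg_mul, mul_neg, mul_assoc]
  · rw [Matrix.trace_mul_comm, ← mul_assoc, hg, one_mul, hX.2]

omit [Nonempty n] in
/-- Conjugation by an `SU(N)` element preserves `𝔰𝔲(N)`. [folklore] -/
theorem su_conj_coe (g : Matrix.specialUnitaryGroup n ℂ) {X : Matrix n n ℂ} (hX : star X = -X ∧ X.trace = 0) :
    star ((g : Matrix n n ℂ) * X * star (g : Matrix n n ℂ)) = -((g : Matrix n n ℂ) * X * star (g : Matrix n n ℂ))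
      ∧ ((g : Matrix n n ℂ) * X * star (g : Matrix n n ℂ)).trace = 0 :=
  su_conj (coe_star_mul_self g) hX

omit [Nonempty n] in
/-- Conjugation by the star of an `SU(N)` element preserves `𝔰𝔲(N)`. [folklore] -/
theorem su_conj_star_coe (g : Matrix.specialUnitaryGroup n ℂ) {X : Matrix n n ℂ} (hX : star X = -X ∧ X.trace = 0) :
    star (star (g : Matrix n n ℂ) * X * (g : Matrix n n ℂ)) = -(star (g : Matrix n n ℂ) * X * (g : Matrix n n ℂ))
      ∧ (star (g : Matrix n n ℂ) * X * (g : Matrix n n ℂ)).trace = 0 := by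
  have h := su_conj (g := star (g : Matrix n n ℂ)) (by rw [star_star]; exact coe_mul_star_self g) hX
  rwa [star_star] at h

variable {P : Params} {j : ℕ}

omit [Nonempty n] in
/-- The covariant step term of an `𝔰𝔲(N)`-valued field is `𝔰𝔲(N)`-valued (`Z_s = Y_b` or `−g_sY_bg_s*`). [cite: Balaban1985Averaging, (56)-(58) p.27] -/
theorem su_covStep (V : GaugeField P j (Matrix.specialUnitaryGroup n ℂ)) {Y : PBond P j → Matrix n n ℂ}
    (hY : ∀ b, star (Y b) = -Y b ∧ (Y b).trace = 0) (s : LStep P j) :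
    star (covStep V Y s) = -covStep V Y s ∧ (covStep V Y s).trace = 0 := by
  unfold covStep
  split_ifs
  · exact hY _
  · exact su_neg (su_conj (star_mul_stepFactor' V s) (hY _))

omit [Nonempty n] in
/-- ★ **The covariant signed sum `Y_V(Γ)` of an `𝔰𝔲(N)`-valued field along any sequence of steps is `𝔰𝔲(N)`-valued.** [cite: Balaban1985Averaging, (58) p.27] -/
theorem su_covWalkSum (V : GaugeField P j (Matrix.specialUnitaryGroup n ℂ)) {Y : PBond P j → Matrix n n ℂ}
    (hY : ∀ b, star (Y b) = -Y b ∧ (Y b).trace = 0) :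
    ∀ γ : List (LStep P j), star (covWalkSum V Y γ) = -covWalkSum V Y γ ∧ (covWalkSum V Y γ).trace = 0
  | [] => by simp
  | s :: γ => by
    rw [covWalkSum_cons]
    exact su_add (su_covStep V hY s) (su_conj (star_mul_stepFactor' V s) (su_covWalkSum V hY γ))


/-! ## §2 ★★ The analytic point: `D eml(W)[i ↦ A_i·W_i]·eml(W)* ∈ 𝔰𝔲(N)` -/

section Analytic

omit [DecidableEq n] [Nonempty n] in
/-- `𝔰𝔲(N)` is closed in `M_N(ℂ)`. [folklore] -/
theorem isClosed_su : IsClosed {X : Matrix n n ℂ | star X = -X ∧ X.trace = 0} := by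
  have h1 : IsClosed {X : Matrix n n ℂ | star X = -X} := isClosed_eq continuous_star continuous_neg
  have h2 : IsClosed {X : Matrix n n ℂ | X.trace = 0} :=
    isClosed_eq ((Matrix.traceLinearMap n ℂ ℂ).continuous_of_finiteDimensional) continuous_const
  exact h1.inter h2

omit [Nonempty n] in
/-- `e^{tA} ∈ SU(N)` for `A ∈ 𝔰𝔲(N)` and real `t` (`(e^{X})* = e^{X*} = e^{−X}`, `det e^{X} = e^{tr X}`). [folklore] -/
theorem exp_smul_mem_specialUnitaryGroup {A : Matrix n n ℂ} (hA : star A = -A ∧ A.trace = 0) (t : ℝ) :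
    exp (((t : ℝ) : ℂ) • A) ∈ Matrix.specialUnitaryGroup n ℂ := by
  letI : NormedAlgebra ℚ (Matrix n n ℂ) := NormedAlgebra.restrictScalars ℚ ℂ _
  have hX : star (((t : ℝ) : ℂ) • A) = -(((t : ℝ) : ℂ) • A) := by
    rw [star_smul, Complex.star_def, Complex.conj_ofReal, hA.1, smul_neg]
  rw [Matrix.mem_specialUnitaryGroup_iff, Matrix.mem_unitaryGroup_iff]
  refine ⟨?_, ?_⟩
  · rw [star_exp, hX, ← exp_add_of_commute (Commute.refl _).neg_right, add_neg_cancel, exp_zero]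
  · rw [det_exp_eq_exp_trace, Matrix.trace_smul, hA.2, smul_zero, exp_zero]

/-- On the (0.4) guard `‖W − 1‖ < δ_N = min(1/3, π/N)`: `‖W − 1‖ ≤ 1/3` and `N·‖W − 1‖ < π`. [cite: Balaban1987RG1, (0.4) p.253 (bookkeeping)] -/
theorem guard_facts {W : Matrix n n ℂ} (h : ‖W - 1‖ < deltaSU n) :
    ‖W - 1‖ ≤ 1 / 3 ∧ (Fintype.card n : ℝ) * ‖W - 1‖ < Real.pi := by
  refine ⟨(lt_third_of_lt_deltaSU h).le, ?_⟩
  have hc : (0 : ℝ) < Fintype.card n := Nat.cast_pos.mpr Fintype.card_pos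
  have h2 : ‖W - 1‖ < Real.pi / Fintype.card n := h.trans_le (min_le_right _ _)
  calc (Fintype.card n : ℝ) * ‖W - 1‖ < Fintype.card n * (Real.pi / Fintype.card n) := mul_lt_mul_of_pos_left h2 hc
    _ = Real.pi := mul_div_cancel₀ _ hc.ne'

/-- ★★ **THE DERIVATIVE OF THE (0.4) CORRECTION FACTOR ALONG `SU(N)`-TANGENT DIRECTIONS IS `𝔰𝔲(N)`-VALUED AFTER RIGHT TRANSLATION TO THE IDENTITY.**
For a tuple `W` of `SU(N)` matrices on the (0.4) guard `‖W_i − 1‖ < δ_N` and `𝔰𝔲(N)`-valued `A_i`: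
`star (D eml(W)[i ↦ A_i·W_i]·eml(W)*) = −(…)` and `tr (…) = 0` — the derivative at `t = 0` of the curve `t ↦ log(eml{e^{tA_i}W_i}·eml{W_i}*)`, which is `𝔰𝔲(N)`-valued
for small REAL `t`; `𝔰𝔲(N)` is closed, so the limit of the real slopes stays in it. [cite: Balaban1985BackgroundPropagators, (3.13)-(3.14) p.393; Balaban1987RG1, (0.4)-(0.9) p.253] -/
theorem fderiv_eml_mul_star_su {ι : Type*} [Fintype ι] (W : ι → Matrix n n ℂ) (hW : ∀ i, W i ∈ Matrix.specialUnitaryGroup n ℂ)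
    (hW1 : ∀ i, ‖W i - 1‖ < deltaSU n) (A : ι → Matrix n n ℂ) (hA : ∀ i, star (A i) = -A i ∧ (A i).trace = 0) :
    star (fderiv ℂ (eml : (ι → Matrix n n ℂ) → Matrix n n ℂ) W (fun i => A i * W i) * star (eml W))
        = -(fderiv ℂ (eml : (ι → Matrix n n ℂ) → Matrix n n ℂ) W (fun i => A i * W i) * star (eml W))
      ∧ (fderiv ℂ (eml : (ι → Matrix n n ℂ) → Matrix n n ℂ) W (fun i => A i * W i) * star (eml W)).trace = 0 := by
  letI : NormedAlgebra ℚ (Matrix n n ℂ) := NormedAlgebra.restrictScalars ℚ ℂ _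
  set D : Matrix n n ℂ := fderiv ℂ (eml : (ι → Matrix n n ℂ) → Matrix n n ℂ) W (fun i => A i * W i) with hDdef
  set E₀ : Matrix n n ℂ := eml W with hE₀
  -- `eml W ∈ SU(N)`
  have hE₀SU : E₀ ∈ Matrix.specialUnitaryGroup n ℂ :=
    eml_mem_specialUnitaryGroup hW (fun i => (guard_facts (hW1 i)).1) (fun i => (guard_facts (hW1 i)).2)
  have hE₀U : E₀ * star E₀ = 1 := Matrix.mem_unitaryGroup_iff.1 (Matrix.mem_specialUnitaryGroup_iff.1 hE₀SU).1
  -- the complex curve `γ(z) = (e^{zA_i}W_i)_i` and its derivative at `0`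
  set γ : ℂ → (ι → Matrix n n ℂ) := fun z i => exp (z • A i) * W i with hγ
  have hγ0 : γ 0 = W := by
    funext i; simp only [hγ, zero_smul, exp_zero, one_mul]
  have hγd : HasDerivAt γ (fun i => A i * W i) 0 := by
    refine hasDerivAt_pi.2 fun i => ?_
    have h1 := hasDerivAt_exp_smul_const' (𝕂 := ℂ) (A i) (0 : ℂ)
    rw [zero_smul, exp_zero, mul_one] at h1
    exact h1.mul_const (W i)
  -- `eml` is differentiable at `W` (guard ⇒ within `1` of `1`); chain rule, then right translation by `E₀*`, then `log` at `1`
  have hW1' : ∀ i, ‖W i - 1‖ < 1 := fun i => (lt_third_of_lt_deltaSU (hW1 i)).trans (by norm_num)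
  have heml : HasFDerivAt (eml : (ι → Matrix n n ℂ) → Matrix n n ℂ) (fderiv ℂ (eml : (ι → Matrix n n ℂ) → Matrix n n ℂ) W) W :=
    (differentiableAt_eml hW1').hasFDerivAt
  have hcomp : HasDerivAt (fun z : ℂ => eml (γ z)) D 0 := heml.comp_hasDerivAt_of_eq (0 : ℂ) hγd hγ0.symm
  have hP : HasDerivAt (fun z : ℂ => eml (γ z) * star E₀) (D * star E₀) 0 := hcomp.mul_const _
  have hP0 : eml (γ 0) * star E₀ = 1 := by rw [hγ0]; exact hE₀U
  have hh : HasDerivAt (fun z : ℂ => mlog (eml (γ z) * star E₀)) (D * star E₀) 0 := by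
    have h := (hasFDerivAt_mlog_one (𝔄 := Matrix n n ℂ)).comp_hasDerivAt_of_eq (0 : ℂ) hP hP0.symm
    rw [show ((1 : Matrix n n ℂ →L[ℂ] Matrix n n ℂ) (D * star E₀)) = D * star E₀ from rfl] at h
    exact h
  have hh0 : mlog (eml (γ 0) * star E₀) = 0 := by rw [hP0, mlog_one]
  -- along REAL parameters the curve is `𝔰𝔲(N)`-valued near `0`
  have hγSU : ∀ (t : ℝ) (i : ι), γ (t : ℂ) i ∈ Matrix.specialUnitaryGroup n ℂ := fun t i =>
    Submonoid.mul_mem _ (exp_smul_mem_specialUnitaryGroup (hA i) t) (hW i)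
  have hopen : IsOpen {X : Matrix n n ℂ | ‖X - 1‖ < deltaSU n} := isOpen_lt (continuous_id.sub continuous_const).norm continuous_const
  have hev_guard : ∀ᶠ t : ℝ in 𝓝 0, ∀ i, ‖γ (t : ℂ) i - 1‖ < deltaSU n := by
    refine Filter.eventually_all.2 fun i => ?_
    have hc : ContinuousAt (fun t : ℝ => γ (t : ℂ) i) 0 :=
      ((hasDerivAt_pi.1 hγd i).continuousAt.comp_of_eq Complex.continuous_ofReal.continuousAt Complex.ofReal_zero)
    have hmem : γ ((0 : ℝ) : ℂ) i ∈ {X : Matrix n n ℂ | ‖X - 1‖ < deltaSU n} := by rw [Complex.ofReal_zero, hγ0]; exact hW1 i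
    exact hc.preimage_mem_nhds (hopen.mem_nhds hmem)
  have hev_prod : ∀ᶠ t : ℝ in 𝓝 0, ‖eml (γ (t : ℂ)) * star E₀ - 1‖ < deltaSU n := by
    have hc : ContinuousAt (fun t : ℝ => eml (γ (t : ℂ)) * star E₀) 0 :=
      hP.continuousAt.comp_of_eq Complex.continuous_ofReal.continuousAt Complex.ofReal_zero
    have hmem : eml (γ ((0 : ℝ) : ℂ)) * star E₀ ∈ {X : Matrix n n ℂ | ‖X - 1‖ < deltaSU n} := by
      rw [Complex.ofReal_zero, hP0]; show ‖(1 : Matrix n n ℂ) - 1‖ < deltaSU n; rw [sub_self, norm_zero]; exact deltaSU_pos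
    exact hc.preimage_mem_nhds (hopen.mem_nhds hmem)
  have hev_su : ∀ᶠ t : ℝ in 𝓝 0, star (mlog (eml (γ (t : ℂ)) * star E₀)) = -mlog (eml (γ (t : ℂ)) * star E₀)
      ∧ (mlog (eml (γ (t : ℂ)) * star E₀)).trace = 0 := by
    filter_upwards [hev_guard, hev_prod] with t ht hp
    have hSU₁ : eml (γ (t : ℂ)) ∈ Matrix.specialUnitaryGroup n ℂ :=
      eml_mem_specialUnitaryGroup (hγSU t) (fun i => (guard_facts (ht i)).1) (fun i => (guard_facts (ht i)).2)
    have hSU : eml (γ (t : ℂ)) * star E₀ ∈ Matrix.specialUnitaryGroup n ℂ := Submonoid.mul_mem _ hSU₁ (FederbushMean.star_mem_SU hE₀SU)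
    exact ⟨star_mlog_eq_neg (Matrix.mem_specialUnitaryGroup_iff.1 hSU).1 (guard_facts hp).1,
      trace_mlog_eq_zero hSU (guard_facts hp).1 (guard_facts hp).2⟩
  -- closedness: the real slopes `t⁻¹ • h(t)` lie in `𝔰𝔲(N)`, hence so does their limit `D·E₀*`
  have hofReal : Tendsto (fun t : ℝ => (t : ℂ)) (𝓝[≠] 0) (𝓝[≠] 0) := by
    have h := Complex.continuous_ofReal.continuousWithinAt.tendsto_nhdsWithin (s := {(0 : ℝ)}ᶜ) (t := {(0 : ℂ)}ᶜ) (x := 0)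
      (fun t ht => by simpa using ht)
    simpa using h
  have hslope := (hh.tendsto_slope_zero).comp hofReal
  rw [hh0] at hslope
  have hev' : ∀ᶠ t : ℝ in 𝓝[≠] 0,
      ((fun t : ℂ => t⁻¹ • (mlog (eml (γ (0 + t)) * star E₀) - 0)) ∘ fun t : ℝ => (t : ℂ)) t ∈ {X : Matrix n n ℂ | star X = -X ∧ X.trace = 0} := by
    refine eventually_nhdsWithin_of_eventually_nhds ?_
    filter_upwards [hev_su] with t ht
    simp only [Function.comp_apply, zero_add, sub_zero]
    exact su_smul_real (by rw [star_inv₀, Complex.star_def, Complex.conj_ofReal]) ht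
  exact isClosed_su.mem_of_tendsto hslope hev'

end Analytic


/-! ## §3 ★★ The true one-step operator `T_V`, the covariant comb mean `CM_V`, the coarse pure gauge `P_V` -/

section OneStep

/-- ★★ **THE TRUE ONE-STEP LINEARISATION OF THE (0.4) AVERAGE PRESERVES `𝔰𝔲(N)`.**  At a background `V ∈ SU(N)` on the (0.4) guard at `c` (`dist1(W_i(c)) < δ_N`), for an
`𝔰𝔲(N)`-valued fine field `Z`, the `hQs` letter `T_V(Z)(c) = D eml(W)[i ↦ Z_V(loop_i)·W_i]·κ* + κ·Z_V([y, y′])·κ*` (`W_i = loopHol V c i`, `κ = corr ℰ V c = eml W` on the guard,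
✓ `Prop7TrueLinPureGauge.coe_corr_eq_eml`) is `𝔰𝔲(N)`-valued: the loop sums `Z_V(loop_i)` are `𝔰𝔲(N)`-valued (§1), §2 treats the first term, unitary conjugation the second.
[cite: Balaban1985BackgroundPropagators, (3.13)-(3.14) p.393; Balaban1985Averaging, Prop. 3 (122)-(125) p.36; Balaban1987RG1, (0.4) p.253] -/
theorem su_trueLin (V : GaugeField P j (Matrix.specialUnitaryGroup n ℂ)) {Z : PBond P j → Matrix n n ℂ}
    (hZ : ∀ b, star (Z b) = -Z b ∧ (Z b).trace = 0) (c : PBond P (j + 1)) (hsmall : ∀ i : Idx P, dist1 (loopHol V c i) < deltaSU n) :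
    star (fderiv ℂ (eml : (Idx P → Matrix n n ℂ) → Matrix n n ℂ)
            (fun i => ((loopHol V c i : Matrix.specialUnitaryGroup n ℂ) : Matrix n n ℂ))
            (fun i => covWalkSum V Z (walk (emb c.src) (loopWord P.L c.dir (off i.1) i.2.1 i.2.2))
              * ((loopHol V c i : Matrix.specialUnitaryGroup n ℂ) : Matrix n n ℂ))
            * star ((corr (expMeanLogSU (n := n)) V c : Matrix.specialUnitaryGroup n ℂ) : Matrix n n ℂ)
          + ((corr (expMeanLogSU (n := n)) V c : Matrix.specialUnitaryGroup n ℂ) : Matrix n n ℂ)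
            * covWalkSum V Z (walk (emb c.src) (List.replicate P.L (c.dir, true)))
            * star ((corr (expMeanLogSU (n := n)) V c : Matrix.specialUnitaryGroup n ℂ) : Matrix n n ℂ))
      = -(fderiv ℂ (eml : (Idx P → Matrix n n ℂ) → Matrix n n ℂ)
            (fun i => ((loopHol V c i : Matrix.specialUnitaryGroup n ℂ) : Matrix n n ℂ))
            (fun i => covWalkSum V Z (walk (emb c.src) (loopWord P.L c.dir (off i.1) i.2.1 i.2.2))
              * ((loopHol V c i : Matrix.specialUnitaryGroup n ℂ) : Matrix n n ℂ))
            * star ((corr (expMeanLogSU (n := n)) V c : Matrix.specialUnitaryGroup n ℂ) : Matrix n n ℂ)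
          + ((corr (expMeanLogSU (n := n)) V c : Matrix.specialUnitaryGroup n ℂ) : Matrix n n ℂ)
            * covWalkSum V Z (walk (emb c.src) (List.replicate P.L (c.dir, true)))
            * star ((corr (expMeanLogSU (n := n)) V c : Matrix.specialUnitaryGroup n ℂ) : Matrix n n ℂ))
    ∧ (fderiv ℂ (eml : (Idx P → Matrix n n ℂ) → Matrix n n ℂ)
            (fun i => ((loopHol V c i : Matrix.specialUnitaryGroup n ℂ) : Matrix n n ℂ))
            (fun i => covWalkSum V Z (walk (emb c.src) (loopWord P.L c.dir (off i.1) i.2.1 i.2.2))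
              * ((loopHol V c i : Matrix.specialUnitaryGroup n ℂ) : Matrix n n ℂ))
            * star ((corr (expMeanLogSU (n := n)) V c : Matrix.specialUnitaryGroup n ℂ) : Matrix n n ℂ)
          + ((corr (expMeanLogSU (n := n)) V c : Matrix.specialUnitaryGroup n ℂ) : Matrix n n ℂ)
            * covWalkSum V Z (walk (emb c.src) (List.replicate P.L (c.dir, true)))
            * star ((corr (expMeanLogSU (n := n)) V c : Matrix.specialUnitaryGroup n ℂ) : Matrix n n ℂ)).trace = 0 := by
  have hκ := coe_corr_eq_eml V c hsmall
  have hW1 : ∀ i : Idx P, ‖((loopHol V c i : Matrix.specialUnitaryGroup n ℂ) : Matrix n n ℂ) - 1‖ < deltaSU n := fun i => by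
    rw [← FederbushMean.dist1_SU_eq]; exact hsmall i
  have h1 := fderiv_eml_mul_star_su (fun i : Idx P => ((loopHol V c i : Matrix.specialUnitaryGroup n ℂ) : Matrix n n ℂ)) (fun i => (loopHol V c i).prop) hW1
    (fun i => covWalkSum V Z (walk (emb c.src) (loopWord P.L c.dir (off i.1) i.2.1 i.2.2))) (fun i => su_covWalkSum V hZ _)
  rw [← hκ] at h1
  have h2 := su_conj_coe (corr (expMeanLogSU (n := n)) V c) (su_covWalkSum V hZ (walk (emb c.src) (List.replicate P.L (c.dir, true))))
  exact su_add h1 h2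

omit [Nonempty n] in
/-- **THE COVARIANT COMB MEAN PRESERVES `𝔰𝔲(N)`**: `CM_V(Z)(z) = |I|⁻¹Σ_i Z_V(Γ^σ_{z,x})` (real weights, covariant signed sums). [cite: Balaban1984PropagatorsI, (1.18)-(1.20) pp.19-20; Balaban1985Averaging, (58) p.27] -/
theorem su_covCombMean (V : GaugeField P j (Matrix.specialUnitaryGroup n ℂ)) {Z : PBond P j → Matrix n n ℂ}
    (hZ : ∀ b, star (Z b) = -Z b ∧ (Z b).trace = 0) (z : Site P (j + 1)) :
    star (((Fintype.card (Idx P) : ℂ))⁻¹ • ∑ i : Idx P, covWalkSum V Z (walk (emb z) (stairWord i.2.1 (off i.1))))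
      = -(((Fintype.card (Idx P) : ℂ))⁻¹ • ∑ i : Idx P, covWalkSum V Z (walk (emb z) (stairWord i.2.1 (off i.1))))
    ∧ (((Fintype.card (Idx P) : ℂ))⁻¹ • ∑ i : Idx P, covWalkSum V Z (walk (emb z) (stairWord i.2.1 (off i.1)))).trace = 0 :=
  su_smul_real (star_inv_natCast _) (su_sum _ fun _ _ => su_covWalkSum V hZ _)

omit [Nonempty n] in
/-- **THE COARSE PURE GAUGE PRESERVES `𝔰𝔲(N)`**: `P_U(ξ)(c) = ξ(c₋) − U(c)ξ(c₊)U(c)*`. [cite: Balaban1985Averaging, (11) p.19] -/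
theorem su_pureGauge {k : ℕ} (U : GaugeField P k (Matrix.specialUnitaryGroup n ℂ)) {ξ ξ' : Matrix n n ℂ}
    (hξ : star ξ = -ξ ∧ ξ.trace = 0) (hξ' : star ξ' = -ξ' ∧ ξ'.trace = 0) (c : PBond P k) :
    star (ξ - ((U c : Matrix.specialUnitaryGroup n ℂ) : Matrix n n ℂ) * ξ' * star ((U c : Matrix.specialUnitaryGroup n ℂ) : Matrix n n ℂ))
      = -(ξ - ((U c : Matrix.specialUnitaryGroup n ℂ) : Matrix n n ℂ) * ξ' * star ((U c : Matrix.specialUnitaryGroup n ℂ) : Matrix n n ℂ))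
    ∧ (ξ - ((U c : Matrix.specialUnitaryGroup n ℂ) : Matrix n n ℂ) * ξ' * star ((U c : Matrix.specialUnitaryGroup n ℂ) : Matrix n n ℂ)).trace = 0 :=
  su_sub hξ (su_conj_coe (U c) hξ')

end OneStep

end Summit.QuantumFields.YangMills.Theorems.Prop7TrueLinReality

end
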